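import Summits.QuantumFields.BalabanUV.Beta.RemainderExplicitHistoryDiagonalSource

/-!
# RemainderExplicitHistoryDiagonalWindow — ROAD P3, ORDER-0 PROFILE FAMILY: THE EXACT WINDOW IDENTITY FOR THE CUTOFF DISCREPANCY AT A
# FIXED INFRARED DISTANCE — for two infrared-pinned runs (A: `K` steps, B: `K + n` steps) the matched discrepancy
# `d_{j₀} = 1∕(g^B_{j₀+n})² − 1∕(g^A_{j₀})²` at ONE position `j₀` (infrared distance `K − j₀`) is EXACTLY «B's extra-age source over the window
# `[j₀, K)`» + «the feedback of the ultraviolet positions `i < j₀`, weight `Σ_{a∈[j₀−i, K−i)} ρ(a)`» + «a window term of weight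
# `Σ_{a<K−i} ρ(a) − Σ_{a≤i} ρ(a)`, NON-POSITIVE in the infrared half `2j₀ + 1 ≥ K`»; hence `Σ_window E ≤ d_{j₀} + W·Σ_window e` (any window, NO
# smallness) and, in the infrared half, `d_{j₀} ≤ Σ_window E + Σ_{i<j₀} e_i·Σ_{a∈[j₀−i,K−i)} ρ(a)` (first file of station S-d4p3-g49-1 «the rate in
# the cutoff»; the second file prices the window source by the missing ages, the third resolves the ultraviolet feedback into a rate)

Cell `pub-balaban`, β-function sub-cell, BINDER row D4 «RemainderConst leaves for Bałaban's split» (`HOME/BINDER-OWNERS.md`; owner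
lineage `b2b-balaban-beta-an4`; this file by co-owner #3 lineage `b2b-balaban-beta-d4-p3`, road P3 «the reduction road», generation 49,
station S-d4p3-g49-1, first file; imports generation 48's `RemainderExplicitHistoryDiagonalSource` (hence `…TwoRun`, `…Weights`,
`…Monotone`)), β-FLOW TEAM duty (1); FREEZE (0) honoured (def-free module in road P3's own `RemainderExplicit*` series; no leaf, no interface, no
Literature file).  SOURCE OF THE SHAPES ONLY: [Balaban1987RG1] (0.20) p. 256, (0.31) and Thm 2 p. 259, §5 p. 298.  Pure real analysis about
ONE explicit toy family (ours).

HONEST FRAMING (page 1 of everything the β sub-cell writes).  *"Discharging BetaPertH makes Bałaban's UV stability UNCONDITIONAL — a real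
constructive-QFT result; it is NOT the continuum limit and NOT the Clay problem."*  THIS FILE DISCHARGES NOTHING OF THE KIND.  Generation 47
proved that the continuum coupling `astar g m` of every pinned family of runs of road P3's order-0 profile family
`β_{k+1} = b + Σ_{i≤k} ρ(k−i)·min(g_k, |g_k − g_i|)` EXISTS (monotone in the cutoff), generation 48 that the TOTAL cutoff discrepancy
`astar g m − invSq g m 0` obeys a two-sided law in `m` (for the MAXIMUM of the matched discrepancies over all positions).  The RATE question —
how fast `invSq g m n → astar g m` in the cutoff `n` at a FIXED infrared distance `m` — needs the discrepancy at ONE position, the infrared-most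
one, where it is much smaller than the maximum (which sits at the ultraviolet end).  This file supplies the exact bookkeeping for that (§1–§2):
summing the matched recursion of `…TwoRun.disc_signed_step_shift` over the window `[j₀, K)` and re-organising the common ages' feedback BY THE
POSITION OF THE COUPLING gives the identity of the title; the self-weight `Σ_{a≤i} ρ(a)` of an OLD position (`2i + 1 ≥ K`) exceeds the weight
`Σ_{a<K−i} ρ(a)` it exerts on the window, so inside the infrared half the window's own feedback is pure damping, and only the ultraviolet
positions `i < j₀` — whose coupling discrepancies `e_i ≤ (g^A_i)³∕2·d_i` carry the cube of an asymptotically free coupling — can pump the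
infrared discrepancy, through the tail-window weights `Σ_{a∈[j₀−i,K−i)} ρ(a)`.  The station's second file
(`RemainderExplicitHistoryDiagonalWindowSource`) prices the window source both ways by the MISSING AGES of each window position and assembles the
two-sided law modulo the ultraviolet feedback; the third resolves the feedback under shape hypotheses on a tail majorant and turns it into a
rate.  Nothing of Bałaban's (1.22) is asserted or constructed; row D4 class UNCHANGED (critical-path width 0; instance 0∕1; D4
DISCHARGE NO DATE); NOT B12 Thm 2, NOT BetaPertH, NOT continuum, NOT Clay.  HONEST DEPENDENCY: continuum YM on T⁴ ⇐ BetaPertH ∧ nine spine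
estimates (0/9 proved); BetaPertH ⇐ (D1) ∧ (D4) ∧ CAP+tail; G-an2-4 gates asym, D1 and NE2/3/4.  ABSOLUTE RULE: nothing is cited as a fact.

WHAT IS PROVED ([folklore]; 0 sorry; 0 `def`; the family as the hypothesis `hβ` on an abstract `β : FlowStep.HBeta`, profile `ρ ≥ 0`, `b > 0`;
`R(k) := Σ_{a<k} ρ(a)` is written out as a `range` sum everywhere).
* §1 (abstract finite sums) `sum_feedback_in`, `sum_feedback_out`, **`sum_window_feedback_eq`**
  (`Σ_{j∈[j₀,K)} Σ_{i≤j} ρ(j−i)(e_i − e_j) = Σ_{i<j₀} e_i (R(K−i) − R(j₀−i)) + Σ_{i∈[j₀,K)} e_i (R(K−i) − R(i+1))`).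
* §2 FOR TWO PINNED RUNS (A: `K` steps, B: `K + n` steps, positive couplings): `disc_step_window` (`d_j − d_{j+1} = E_j + Σ_{i≤j} ρ(j−i)(e_i − e_j)`),
  **`window_identity`** (the title), `partialSum_mono`, **`window_upper`** (`2j₀+1 ≥ K` ⇒ `d_{j₀} ≤ Σ_{[j₀,K)} E + Σ_{i<j₀} e_i (R(K−i) − R(j₀−i))`),
  **`window_lower`** (`Σ_{[j₀,K)} E ≤ d_{j₀} + W·Σ_{[j₀,K)} e`, any `j₀ ≤ K`, NO smallness), `window_lower_max` (`… ≤ d_{j₀} + (Wγ∕b)·P` for any bound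
  `P` of `d` on `[j₀,K]`, couplings in ]0,γ]).
All letters NOT-IN-PRINT; `BetaFlowAsPrinted S` records a Markov β_n only ⇒ no junction of the as-printed interface changes.
-/

noncomputable section

open Finset Filter Topology

namespace Summit.QuantumFields.BalabanUV.Beta.RemainderExplicitHistoryDiagonalWindow

open Literature.MathematicalPhysics.QuantumFieldTheory.Balaban1983to89
open Literature.MathematicalPhysics.QuantumFieldTheory.Balaban1983to89.FlowStep
open Literature.MathematicalPhysics.QuantumFieldTheory.Balaban1983to89.T4CouplingMatching
open Summit.QuantumFields.BalabanUV.Beta.RemainderExplicitHistoryDiagonalMonotone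
open Summit.QuantumFields.BalabanUV.Beta.RemainderExplicitHistoryDiagonalWeights
open Summit.QuantumFields.BalabanUV.Beta.RemainderExplicitHistoryDiagonalTwoRun
open Summit.QuantumFields.BalabanUV.Beta.RemainderExplicitHistoryDiagonalSource

variable {β : HBeta} {b γ W : ℝ} {ρ : ℕ → ℝ}

/-! ## §1 Re-organising the common ages' feedback over a window by the position of the coupling -/

/-- INCOMING FEEDBACK, BY POSITION: `Σ_{j<L} Σ_{i≤j} ρ(j−i)·e_i = Σ_{i<L} e_i·Σ_{a<L−i} ρ(a)`. [folklore] -/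
theorem sum_feedback_in (ρ e : ℕ → ℝ) (L : ℕ) :
    ∑ j ∈ range L, ∑ i ∈ range (j + 1), ρ (j - i) * e i = ∑ i ∈ range L, e i * ∑ a ∈ range (L - i), ρ a := by
  have hswap : ∑ j ∈ range L, ∑ i ∈ range (j + 1), ρ (j - i) * e i = ∑ i ∈ range L, ∑ j ∈ Ico i L, ρ (j - i) * e i := by
    simp only [Finset.range_eq_Ico]
    exact (Finset.sum_Ico_Ico_comm 0 L (fun i j => ρ (j - i) * e i)).symm
  rw [hswap]
  refine Finset.sum_congr rfl fun i _ => ?_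
  rw [Finset.sum_Ico_eq_sum_range, Finset.mul_sum]
  refine Finset.sum_congr rfl fun a _ => ?_
  rw [Nat.add_sub_cancel_left, mul_comm]

/-- OUTGOING SELF-WEIGHT, BY POSITION: `Σ_{j<L} Σ_{i≤j} ρ(j−i)·e_j = Σ_{j<L} e_j·Σ_{a<j+1} ρ(a)`. [folklore] -/
theorem sum_feedback_out (ρ e : ℕ → ℝ) (L : ℕ) :
    ∑ j ∈ range L, ∑ i ∈ range (j + 1), ρ (j - i) * e j = ∑ j ∈ range L, e j * ∑ a ∈ range (j + 1), ρ a := by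
  refine Finset.sum_congr rfl fun j _ => ?_
  rw [← Finset.sum_mul, mul_comm]
  congr 1
  rw [← Finset.sum_range_reflect ρ (j + 1)]
  refine Finset.sum_congr rfl fun i hi => ?_
  have hi' := Finset.mem_range.mp hi
  rw [show j + 1 - 1 - i = j - i by omega]

/-- **THE WINDOW FEEDBACK BY POSITION.**  For any `ρ e : ℕ → ℝ` and `j₀ ≤ K`, with `R(k) = Σ_{a<k} ρ(a)`:
`Σ_{j∈[j₀,K)} Σ_{i≤j} ρ(j−i)·(e_i − e_j) = Σ_{i<j₀} e_i·(R(K−i) − R(j₀−i)) + Σ_{i∈[j₀,K)} e_i·(R(K−i) − R(i+1))` — an ultraviolet position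
`i < j₀` feeds the window through the ages `[j₀−i, K−i)`; a window position exerts `R(K−i)` on the window and receives `R(i+1)`. [folklore] -/
theorem sum_window_feedback_eq (ρ e : ℕ → ℝ) {j₀ K : ℕ} (hj₀ : j₀ ≤ K) :
    ∑ j ∈ Ico j₀ K, ∑ i ∈ range (j + 1), ρ (j - i) * (e i - e j)
      = (∑ i ∈ range j₀, e i * (∑ a ∈ range (K - i), ρ a - ∑ a ∈ range (j₀ - i), ρ a))
        + ∑ i ∈ Ico j₀ K, e i * (∑ a ∈ range (K - i), ρ a - ∑ a ∈ range (i + 1), ρ a) := by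
  set G : ℕ → ℝ := fun j => ∑ i ∈ range (j + 1), ρ (j - i) * (e i - e j) with hG
  have hGsplit : ∀ j, G j = (∑ i ∈ range (j + 1), ρ (j - i) * e i) - ∑ i ∈ range (j + 1), ρ (j - i) * e j := by
    intro j
    simp only [hG, mul_sub, Finset.sum_sub_distrib]
  have hfull : ∀ L, ∑ j ∈ range L, G j = (∑ i ∈ range L, e i * ∑ a ∈ range (L - i), ρ a)
      - ∑ j ∈ range L, e j * ∑ a ∈ range (j + 1), ρ a := by
    intro L
    rw [Finset.sum_congr rfl fun j _ => hGsplit j, Finset.sum_sub_distrib, sum_feedback_in, sum_feedback_out]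
  have hwin : ∑ j ∈ Ico j₀ K, G j = (∑ j ∈ range K, G j) - ∑ j ∈ range j₀, G j := Finset.sum_Ico_eq_sub _ hj₀
  have hA : ∑ i ∈ range K, e i * ∑ a ∈ range (K - i), ρ a
      = (∑ i ∈ range j₀, e i * ∑ a ∈ range (K - i), ρ a) + ∑ i ∈ Ico j₀ K, e i * ∑ a ∈ range (K - i), ρ a :=
    (Finset.sum_range_add_sum_Ico _ hj₀).symm
  have hB : ∑ j ∈ Ico j₀ K, e j * ∑ a ∈ range (j + 1), ρ a
      = (∑ j ∈ range K, e j * ∑ a ∈ range (j + 1), ρ a) - ∑ j ∈ range j₀, e j * ∑ a ∈ range (j + 1), ρ a :=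
    Finset.sum_Ico_eq_sub _ hj₀
  have h1 : ∑ i ∈ range j₀, e i * (∑ a ∈ range (K - i), ρ a - ∑ a ∈ range (j₀ - i), ρ a)
      = (∑ i ∈ range j₀, e i * ∑ a ∈ range (K - i), ρ a) - ∑ i ∈ range j₀, e i * ∑ a ∈ range (j₀ - i), ρ a := by
    rw [← Finset.sum_sub_distrib]
    exact Finset.sum_congr rfl fun i _ => by ring
  have h2 : ∑ i ∈ Ico j₀ K, e i * (∑ a ∈ range (K - i), ρ a - ∑ a ∈ range (i + 1), ρ a)
      = (∑ i ∈ Ico j₀ K, e i * ∑ a ∈ range (K - i), ρ a) - ∑ i ∈ Ico j₀ K, e i * ∑ a ∈ range (i + 1), ρ a := by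
    rw [← Finset.sum_sub_distrib]
    exact Finset.sum_congr rfl fun i _ => by ring
  show ∑ j ∈ Ico j₀ K, G j = _
  rw [hwin, hfull K, hfull j₀, h1, h2, hA, hB]
  ring

/-! ## §2 The window identity for two pinned runs, and its two one-sided consequences -/

/-- THE MATCHED RECURSION AS A STEP OF `d`: for two runs of the family (A: `K` steps, B: `K + n` steps, positive couplings) and `j < K`,
with `d_j = 1∕(g^B_{j+n})² − 1∕(g^A_j)²`, `e_i = g^A_i − g^B_{i+n}`, `E_j = Σ_{i<n} ρ(j+n−i)(g^B_{j+n} − g^B_i)`: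
`d_j − d_{j+1} = E_j + Σ_{i≤j} ρ(j−i)·(e_i − e_j)` (`…TwoRun.disc_signed_step_shift` re-signed). [cite: Balaban1987RG1, (0.20) p.256] -/
theorem disc_step_window
    (hβ : ∀ (k : ℕ) (p : Fin (k + 1) → ℝ),
      β k p = b + ∑ i : Fin (k + 1), ρ (k - i) * min (p (Fin.last k)) (|p (Fin.last k) - p i|))
    (hb : 0 < b) (hρ0 : ∀ a, 0 ≤ ρ a) {K n : ℕ} {gA gB : ℕ → ℝ} (hA : RGEqH K β gA) (hB : RGEqH (K + n) β gB)
    (hApos : ∀ k, k ≤ K → 0 < gA k) (hBpos : ∀ k, k ≤ K + n → 0 < gB k) {j : ℕ} (hj : j < K) :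
    (1 / (gB (j + n)) ^ 2 - 1 / (gA j) ^ 2) - (1 / (gB (j + 1 + n)) ^ 2 - 1 / (gA (j + 1)) ^ 2)
      = (∑ i ∈ range n, ρ (j + n - i) * (gB (j + n) - gB i))
        + ∑ i ∈ range (j + 1), ρ (j - i) * ((gA i - gB (i + n)) - (gA j - gB (j + n))) := by
  have eq := disc_signed_step_shift hβ hb hρ0 hA hB hApos hBpos hj
  rw [Nat.add_right_comm j n 1] at eq
  have e3 : ∑ i ∈ range (j + 1), ρ (j - i) * ((gA i - gB (i + n)) - (gA j - gB (j + n)))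
      = ∑ i ∈ range (j + 1), ρ (j - i) * ((gB (j + n) - gA j) - (gB (i + n) - gA i)) :=
    Finset.sum_congr rfl fun i _ => by ring
  rw [e3]
  linarith

/-- **THE WINDOW IDENTITY.**  Two runs of the order-0 profile family (`b > 0`, `ρ ≥ 0`; A: `K` steps, B: `K + n` steps, positive couplings)
pinned `g^A_K = g^B_{K+n}`; `R(k) = Σ_{a<k} ρ(a)`.  THEN for every `j₀ ≤ K`:
`1∕(g^B_{j₀+n})² − 1∕(g^A_{j₀})² = Σ_{j∈[j₀,K)} E_j + Σ_{i<j₀} e_i·(R(K−i) − R(j₀−i)) + Σ_{i∈[j₀,K)} e_i·(R(K−i) − R(i+1))`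
(`E_j` = B's extra-age source at `j`, `e_i = g^A_i − g^B_{i+n}`): backward accumulation from the pin is EXACT, and the common ages' feedback
`Σ_j Σ_{i≤j} ρ(j−i)(e_i − e_j)` over the window is re-organised by `sum_window_feedback_eq`. [cite: Balaban1987RG1, (0.20) p.256 and Thm 2 p.259] -/
theorem window_identity
    (hβ : ∀ (k : ℕ) (p : Fin (k + 1) → ℝ),
      β k p = b + ∑ i : Fin (k + 1), ρ (k - i) * min (p (Fin.last k)) (|p (Fin.last k) - p i|))
    (hb : 0 < b) (hρ0 : ∀ a, 0 ≤ ρ a) {K n : ℕ} {gA gB : ℕ → ℝ} (hA : RGEqH K β gA) (hB : RGEqH (K + n) β gB)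
    (hApos : ∀ k, k ≤ K → 0 < gA k) (hBpos : ∀ k, k ≤ K + n → 0 < gB k) (hpin : gA K = gB (K + n)) {j₀ : ℕ} (hj₀ : j₀ ≤ K) :
    1 / (gB (j₀ + n)) ^ 2 - 1 / (gA j₀) ^ 2
      = (∑ j ∈ Ico j₀ K, ∑ i ∈ range n, ρ (j + n - i) * (gB (j + n) - gB i))
        + (∑ i ∈ range j₀, (gA i - gB (i + n)) * (∑ a ∈ range (K - i), ρ a - ∑ a ∈ range (j₀ - i), ρ a))
        + ∑ i ∈ Ico j₀ K, (gA i - gB (i + n)) * (∑ a ∈ range (K - i), ρ a - ∑ a ∈ range (i + 1), ρ a) := by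
  set d : ℕ → ℝ := fun j => 1 / (gB (j + n)) ^ 2 - 1 / (gA j) ^ 2 with hd
  set e : ℕ → ℝ := fun i => gA i - gB (i + n) with he
  have hstep : ∀ j, j < K → d j - d (j + 1)
      = (∑ i ∈ range n, ρ (j + n - i) * (gB (j + n) - gB i)) + ∑ i ∈ range (j + 1), ρ (j - i) * (e i - e j) :=
    fun j hj => disc_step_window hβ hb hρ0 hA hB hApos hBpos hj
  have htel : ∑ j ∈ Ico j₀ K, (d j - d (j + 1)) = d j₀ - d K := by
    rw [Finset.sum_Ico_eq_sum_range]
    have := Finset.sum_range_sub' (fun t => d (j₀ + t)) (K - j₀)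
    simp only [Nat.add_zero] at this
    rw [show j₀ + (K - j₀) = K by omega] at this
    rw [← this]
    exact Finset.sum_congr rfl fun t _ => by rw [Nat.add_assoc]
  have hdK : d K = 0 := by simp [hd, hpin]
  have hsum : d j₀ = ∑ j ∈ Ico j₀ K, ((∑ i ∈ range n, ρ (j + n - i) * (gB (j + n) - gB i))
      + ∑ i ∈ range (j + 1), ρ (j - i) * (e i - e j)) := by
    rw [← Finset.sum_congr rfl fun j hj => hstep j (Finset.mem_Ico.mp hj).2, htel, hdK, sub_zero]
  show d j₀ = _
  rw [hsum, Finset.sum_add_distrib, sum_window_feedback_eq ρ e hj₀]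
  simp only [he]
  ring

/-- Partial sums of a nonnegative profile are monotone: `k ≤ l ⇒ Σ_{a<k} ρ(a) ≤ Σ_{a<l} ρ(a)`. [folklore] -/
theorem partialSum_mono (hρ0 : ∀ a, 0 ≤ ρ a) {k l : ℕ} (hkl : k ≤ l) :
    ∑ a ∈ range k, ρ a ≤ ∑ a ∈ range l, ρ a :=
  Finset.sum_le_sum_of_subset_of_nonneg (Finset.range_mono hkl) fun a _ _ => hρ0 a

/-- **UPPER WINDOW INEQUALITY (infrared half).**  Same two pinned runs; if `2j₀ + 1 ≥ K` (the window `[j₀, K]` lies in the infrared half), then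
`1∕(g^B_{j₀+n})² − 1∕(g^A_{j₀})² ≤ Σ_{j∈[j₀,K)} E_j + Σ_{i<j₀} e_i·(R(K−i) − R(j₀−i))` — every window position is OLD (`K − i ≤ i + 1`), so its
self-weight `R(i+1)` dominates the weight `R(K−i)` it exerts on the window and the window's own feedback is `≤ 0` (`e ≥ 0` by the maximum
principle `…TwoRun.invSq_le_invSq_shift_run`). [cite: Balaban1987RG1, (0.20) p.256 and Thm 2 p.259] -/
theorem window_upper
    (hβ : ∀ (k : ℕ) (p : Fin (k + 1) → ℝ),
      β k p = b + ∑ i : Fin (k + 1), ρ (k - i) * min (p (Fin.last k)) (|p (Fin.last k) - p i|))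
    (hb : 0 < b) (hρ0 : ∀ a, 0 ≤ ρ a) {K n : ℕ} {gA gB : ℕ → ℝ} (hA : RGEqH K β gA) (hB : RGEqH (K + n) β gB)
    (hApos : ∀ k, k ≤ K → 0 < gA k) (hBpos : ∀ k, k ≤ K + n → 0 < gB k) (hpin : gA K = gB (K + n)) {j₀ : ℕ} (hj₀ : j₀ ≤ K)
    (hIR : K ≤ 2 * j₀ + 1) :
    1 / (gB (j₀ + n)) ^ 2 - 1 / (gA j₀) ^ 2
      ≤ (∑ j ∈ Ico j₀ K, ∑ i ∈ range n, ρ (j + n - i) * (gB (j + n) - gB i))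
        + ∑ i ∈ range j₀, (gA i - gB (i + n)) * (∑ a ∈ range (K - i), ρ a - ∑ a ∈ range (j₀ - i), ρ a) := by
  rw [window_identity hβ hb hρ0 hA hB hApos hBpos hpin hj₀]
  have hdom := invSq_le_invSq_shift_run hβ hb hρ0 hA hB hApos hBpos hpin
  have hneg : ∑ i ∈ Ico j₀ K, (gA i - gB (i + n)) * (∑ a ∈ range (K - i), ρ a - ∑ a ∈ range (i + 1), ρ a) ≤ 0 := by
    refine Finset.sum_nonpos fun i hi => ?_
    have hi' := Finset.mem_Ico.mp hi
    have he : 0 ≤ gA i - gB (i + n) := by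
      linarith [le_of_one_div_sq_le (hApos i hi'.2.le) (hBpos (i + n) (by omega)) (hdom i hi'.2.le)]
    have hR : ∑ a ∈ range (K - i), ρ a ≤ ∑ a ∈ range (i + 1), ρ a := partialSum_mono hρ0 (by omega)
    exact mul_nonpos_of_nonneg_of_nonpos he (by linarith)
  linarith

/-- **LOWER WINDOW INEQUALITY (no smallness, any window).**  Same two pinned runs with `Σ_{a<N} ρ(a) ≤ W`; for every `j₀ ≤ K`:
`Σ_{j∈[j₀,K)} E_j ≤ (1∕(g^B_{j₀+n})² − 1∕(g^A_{j₀})²) + W·Σ_{i∈[j₀,K)} e_i` — the ultraviolet feedback is `≥ 0`, and a window position can damp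
at most by its self-weight `R(i+1) ≤ W`. [cite: Balaban1987RG1, (0.20) p.256 and Thm 2 p.259] -/
theorem window_lower
    (hβ : ∀ (k : ℕ) (p : Fin (k + 1) → ℝ),
      β k p = b + ∑ i : Fin (k + 1), ρ (k - i) * min (p (Fin.last k)) (|p (Fin.last k) - p i|))
    (hb : 0 < b) (hρ0 : ∀ a, 0 ≤ ρ a) (hρW : ∀ n, ∑ a ∈ range n, ρ a ≤ W) {K n : ℕ} {gA gB : ℕ → ℝ}
    (hA : RGEqH K β gA) (hB : RGEqH (K + n) β gB) (hApos : ∀ k, k ≤ K → 0 < gA k) (hBpos : ∀ k, k ≤ K + n → 0 < gB k)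
    (hpin : gA K = gB (K + n)) {j₀ : ℕ} (hj₀ : j₀ ≤ K) :
    ∑ j ∈ Ico j₀ K, ∑ i ∈ range n, ρ (j + n - i) * (gB (j + n) - gB i)
      ≤ (1 / (gB (j₀ + n)) ^ 2 - 1 / (gA j₀) ^ 2) + W * ∑ i ∈ Ico j₀ K, (gA i - gB (i + n)) := by
  rw [window_identity hβ hb hρ0 hA hB hApos hBpos hpin hj₀]
  have hdom := invSq_le_invSq_shift_run hβ hb hρ0 hA hB hApos hBpos hpin
  have he : ∀ i, i ≤ K → 0 ≤ gA i - gB (i + n) := fun i hi => by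
    linarith [le_of_one_div_sq_le (hApos i hi) (hBpos (i + n) (by omega)) (hdom i hi)]
  have huv : 0 ≤ ∑ i ∈ range j₀, (gA i - gB (i + n)) * (∑ a ∈ range (K - i), ρ a - ∑ a ∈ range (j₀ - i), ρ a) := by
    refine Finset.sum_nonneg fun i hi => mul_nonneg (he i (by have := Finset.mem_range.mp hi; omega)) ?_
    linarith [partialSum_mono hρ0 (show j₀ - i ≤ K - i by omega)]
  have hwin : -(W * ∑ i ∈ Ico j₀ K, (gA i - gB (i + n)))
      ≤ ∑ i ∈ Ico j₀ K, (gA i - gB (i + n)) * (∑ a ∈ range (K - i), ρ a - ∑ a ∈ range (i + 1), ρ a) := by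
    rw [Finset.mul_sum, ← Finset.sum_neg_distrib]
    refine Finset.sum_le_sum fun i hi => ?_
    have hi' := Finset.mem_Ico.mp hi
    have h1 := he i hi'.2.le
    have h2 : 0 ≤ ∑ a ∈ range (K - i), ρ a := Finset.sum_nonneg fun a _ => hρ0 a
    have h3 := hρW (i + 1)
    nlinarith
  linarith

/-- LOWER WINDOW INEQUALITY AGAINST A BOUND OF THE WINDOW: same runs, couplings in ]0,γ] (`γ > 0`); if `d_i ≤ P` for all `i ∈ [j₀, K]`, then
`Σ_{j∈[j₀,K)} E_j ≤ d_{j₀} + (Wγ∕b)·P` (`e_i ≤ (g^A_i)³∕2·d_i`, `Σ_{i<K} (g^A_i)³ ≤ 2γ∕b`). [cite: Balaban1987RG1, (0.31) p.259] -/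
theorem window_lower_max
    (hβ : ∀ (k : ℕ) (p : Fin (k + 1) → ℝ),
      β k p = b + ∑ i : Fin (k + 1), ρ (k - i) * min (p (Fin.last k)) (|p (Fin.last k) - p i|))
    (hb : 0 < b) (hγ : 0 < γ) (hρ0 : ∀ a, 0 ≤ ρ a) (hρW : ∀ n, ∑ a ∈ range n, ρ a ≤ W) {K n : ℕ} {gA gB : ℕ → ℝ}
    (hA : RGEqH K β gA) (hB : RGEqH (K + n) β gB) (hAbox : ∀ k, k ≤ K → 0 < gA k ∧ gA k ≤ γ)
    (hBbox : ∀ k, k ≤ K + n → 0 < gB k ∧ gB k ≤ γ) (hpin : gA K = gB (K + n)) {j₀ : ℕ} (hj₀ : j₀ ≤ K) {P : ℝ}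
    (hP : ∀ i, j₀ ≤ i → i ≤ K → 1 / (gB (i + n)) ^ 2 - 1 / (gA i) ^ 2 ≤ P) :
    ∑ j ∈ Ico j₀ K, ∑ i ∈ range n, ρ (j + n - i) * (gB (j + n) - gB i)
      ≤ (1 / (gB (j₀ + n)) ^ 2 - 1 / (gA j₀) ^ 2) + W * γ / b * P := by
  have hApos : ∀ k, k ≤ K → 0 < gA k := fun k hk => (hAbox k hk).1
  have hBpos : ∀ k, k ≤ K + n → 0 < gB k := fun k hk => (hBbox k hk).1
  have hlo : BetaLowerH b γ β :=
    RemainderExplicitHistoryHalfMomentWitness.lower (γ := γ) (lam := fun k i => ρ (k - i)) hβ (fun k i => hρ0 _)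
  have hW : 0 ≤ W := by simpa using hρW 0
  have hdom := invSq_le_invSq_shift_run hβ hb hρ0 hA hB hApos hBpos hpin
  have hBA : ∀ i, i ≤ K → gB (i + n) ≤ gA i := fun i hi =>
    le_of_one_div_sq_le (hApos i hi) (hBpos (i + n) (by omega)) (hdom i hi)
  have hP0 : 0 ≤ P := by
    have h1 := hP K hj₀ le_rfl
    have h2 := hdom K le_rfl
    linarith
  have h0 := window_lower hβ hb hρ0 hρW hA hB hApos hBpos hpin hj₀
  -- the window's coupling discrepancies: `Σ_{[j₀,K)} e ≤ (γ∕b)·P`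
  have hsum_e : ∑ i ∈ Ico j₀ K, (gA i - gB (i + n)) ≤ γ / b * P := by
    calc ∑ i ∈ Ico j₀ K, (gA i - gB (i + n)) ≤ ∑ i ∈ Ico j₀ K, (gA i) ^ 3 / 2 * P := by
          refine Finset.sum_le_sum fun i hi => ?_
          have hi' := Finset.mem_Ico.mp hi
          exact (gap_le_cube_mul (hBpos (i + n) (by omega)) (hBA i hi'.2.le)).trans
            (mul_le_mul_of_nonneg_left (hP i hi'.1 hi'.2.le) (by have := hApos i hi'.2.le; positivity))
      _ ≤ ∑ i ∈ range K, (gA i) ^ 3 / 2 * P :=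
          Finset.sum_le_sum_of_subset_of_nonneg (fun i hi => Finset.mem_range.mpr (Finset.mem_Ico.mp hi).2)
            fun i hi _ => by have := hApos i (Finset.mem_range.mp hi).le; positivity
      _ = P / 2 * ∑ i ∈ range K, (gA i) ^ 3 := by rw [Finset.mul_sum]; exact Finset.sum_congr rfl fun i _ => by ring
      _ ≤ P / 2 * (2 * γ / b) := by
          refine mul_le_mul_of_nonneg_left ?_ (by positivity)
          calc ∑ i ∈ range K, (gA i) ^ 3 ≤ ∑ i ∈ range K, 1 / (sprof γ b (K - i)) ^ 2 * (1 / sprof γ b (K - i)) :=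
                Finset.sum_le_sum fun i hi => cube_le_weight hγ hb hA hAbox hlo (Finset.mem_range.mp hi).le
            _ ≤ 2 * γ / b := sum_weights_lt_le hγ hb K
      _ = γ / b * P := by ring
  have := mul_le_mul_of_nonneg_left hsum_e hW
  calc ∑ j ∈ Ico j₀ K, ∑ i ∈ range n, ρ (j + n - i) * (gB (j + n) - gB i)
      ≤ (1 / (gB (j₀ + n)) ^ 2 - 1 / (gA j₀) ^ 2) + W * ∑ i ∈ Ico j₀ K, (gA i - gB (i + n)) := h0
    _ ≤ (1 / (gB (j₀ + n)) ^ 2 - 1 / (gA j₀) ^ 2) + W * (γ / b * P) := by linarith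
    _ = (1 / (gB (j₀ + n)) ^ 2 - 1 / (gA j₀) ^ 2) + W * γ / b * P := by ring

end Summit.QuantumFields.BalabanUV.Beta.RemainderExplicitHistoryDiagonalWindow

end
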